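import Mathlib
import HarnessLib
import Summits.AtomisticToContinuum.Crystallization.Theses.PRVarianceCertificate
import Summits.AtomisticToContinuum.Crystallization.Theorems.PRVarianceCertificateGroundStateVarianceCertificateStubVirialSite
import Summits.AtomisticToContinuum.Crystallization.Theorems.PRVarianceCertificateGroundStateVarianceCertificateStubSmallClusters
import Summits.AtomisticToContinuum.Crystallization.Theorems.PRVarianceCertificateGroundStateVarianceCertificateAttainment

/-!
# Crux `GroundStateVarianceCertificate` (stmt-AtomisticToContinuum-11859), line `registered`:
# the open core is exactly the crux minus attainment

Helper file of the lead (c2) for the registered stub `stub_coreDomination` of the line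
`Cruxes/GroundStateVarianceCertificate/Lines/birth.lean` (route `PRVarianceCertificate`).
With `stub_virialSite` (virial identity, site form) and `stub_smallClusters` (`N ≤ 4`) landed, the
skeleton's remaining gaps are `stub_periodicMinimiser` (= item stmt-AtomisticToContinuum-0627,
`stubPeriodicMinimiser_iff_crysPeriodicMinAttained`) and the CORE

  `CoreDomination :≡ ∀ N ≥ 5, ∀ LJ ground states x with Σ_i t_i = Σ_i s_i,
     ∃ Q periodic, Σ_i s_i² ≤ (-24·e_LJ(Q)) · Σ_i t_i`

(`s_i = siteEnergy (r ↦ r⁻⁶) x i`, `t_i = siteEnergy (r ↦ r⁻¹²) x i`). This file records, sorry-free: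

* `periodicDomination_of_core` — the skeleton's by-particle-number assembly against the LANDED stubs:
  the core alone gives periodic domination of EVERY finite ground state (small clusters are dominated
  by the certified periodic energy `e(fcc, a = 1) ≤ -1/2`, virial balance comes from `stub_virialSite`).
* `groundStateVarianceCertificate_iff_attained_and_core` — **the crux is EXACTLY attainment (0627) ∧
  the core**: `GroundStateVarianceCertificate ↔ (∃ P, ∀ Q, e(P) ≤ e(Q)) ∧ CoreDomination`. So the
  registered stub `stub_coreDomination` is crux-sized by theorem, not by estimate: given item 0627 it
  is equivalent to the crux.
* `core_of_varianceCertificate`, `core_of_coerciveVarianceCertificate` — the core is implied by the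
  route's stronger cruxes `VarianceCertificate` (stmt-11861, all injective configurations) and
  `CoerciveVarianceCertificate` (stmt-11860, defect-counting form), each in two lines (`Q := P`).

No new definitions; the core statement is written inline verbatim as registered. All `[folklore]`.
-/

noncomputable section

open scoped BigOperators
open Literature.MathematicalPhysics.StatisticalMechanics

namespace Summit.AtomisticToContinuum.Crystallization.Theorems.GroundStateVarianceCertificateLine

/-- `Σ_i t_i ≥ 0`: site sums of twelfth powers of inverse distances are non-negative. [folklore] -/
theorem sum_siteEnergy_inv_pow_twelve_nonneg {N : ℕ} (x : Fin N → EuclideanSpace ℝ (Fin 3)) :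
    0 ≤ ∑ i, siteEnergy (fun r => (r⁻¹) ^ 12) x i := by
  refine Finset.sum_nonneg fun i _ => ?_
  unfold siteEnergy
  exact Finset.sum_nonneg fun k _ => by positivity

/-- **Periodic domination from the core** (the skeleton's assembly `periodicDomination_of_stubs`
run against the landed stubs): if every Lennard-Jones ground state of `N ≥ 5` particles in virial
balance is dominated by some periodic `Q`, then EVERY finite Lennard-Jones ground state is — for
`N ≤ 4` take `Q` = fcc at nearest-neighbour distance `1` (`e ≤ -1/2`, so `-24 e ≥ 12 ≥ 3`, and
`stub_smallClusters`), for `N ≥ 5` the virial balance is `stub_virialSite`. [folklore] -/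
theorem periodicDomination_of_core
    (hcore : ∀ (N : ℕ) (x : Fin N → EuclideanSpace ℝ (Fin 3)), 5 ≤ N → IsGroundState lennardJones x →
      ∑ i, siteEnergy (fun r => (r⁻¹) ^ 12) x i = ∑ i, siteEnergy (fun r => (r⁻¹) ^ 6) x i →
      ∃ Q : PeriodicConfiguration 3,
        ∑ i, (siteEnergy (fun r => (r⁻¹) ^ 6) x i) ^ 2 ≤
          (-24 * Q.energyPerParticle lennardJones) * ∑ i, siteEnergy (fun r => (r⁻¹) ^ 12) x i) :
    ∀ (N : ℕ) (x : Fin N → EuclideanSpace ℝ (Fin 3)), IsGroundState lennardJones x →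
      ∃ Q : PeriodicConfiguration 3,
        ∑ i, (siteEnergy (fun r => (r⁻¹) ^ 6) x i) ^ 2 ≤
          (-24 * Q.energyPerParticle lennardJones) * ∑ i, siteEnergy (fun r => (r⁻¹) ^ 12) x i := by
  intro N x hx
  rcases Nat.lt_or_ge 4 N with hN | hN
  · exact hcore N x (by omega) hx (stub_virialSite N x hx)
  · refine ⟨_root_.Summit.AtomisticToContinuum.Crystallization.Theorems.LayeredLawsSelectHcp.Negative.FccEnergy.fccPC
      one_ne_zero, (stub_smallClusters N x hN hx).trans ?_⟩
    have he := _root_.Summit.AtomisticToContinuum.Crystallization.Theorems.LayeredLawsSelectHcp.Negative.Threshold.energyPerParticle_fccPC_one_le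
    exact mul_le_mul_of_nonneg_right (by linarith) (sum_siteEnergy_inv_pow_twelve_nonneg x)

/-- **The crux is exactly attainment ∧ the core.** `GroundStateVarianceCertificate` holds iff the
periodic Lennard-Jones minimum is attained (`∃ P, ∀ Q, e(P) ≤ e(Q)`, = item
stmt-AtomisticToContinuum-0627 by `stubPeriodicMinimiser_iff_crysPeriodicMinAttained`) AND every
ground state of `N ≥ 5` particles in virial balance is dominated by a periodic configuration (the
registered stub `stub_coreDomination` of line `registered`). `→`: attainment by
`stubPeriodicMinimiser_of_groundStateVarianceCertificate`, the core with `Q := P` (`C ≤ -24 e(P)`);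
`←`: `periodicDomination_of_core` and the losslessness theorem
`groundStateVarianceCertificate_iff_attained_and_dominated`. [folklore] -/
theorem groundStateVarianceCertificate_iff_attained_and_core :
    _root_.Summit.AtomisticToContinuum.Crystallization.Theses.PRVarianceCertificate.GroundStateVarianceCertificate ↔
    ((∃ P : PeriodicConfiguration 3, ∀ Q : PeriodicConfiguration 3,
        P.energyPerParticle lennardJones ≤ Q.energyPerParticle lennardJones) ∧
      ∀ (N : ℕ) (x : Fin N → EuclideanSpace ℝ (Fin 3)), 5 ≤ N → IsGroundState lennardJones x →
        ∑ i, siteEnergy (fun r => (r⁻¹) ^ 12) x i = ∑ i, siteEnergy (fun r => (r⁻¹) ^ 6) x i →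
        ∃ Q : PeriodicConfiguration 3,
          ∑ i, (siteEnergy (fun r => (r⁻¹) ^ 6) x i) ^ 2 ≤
            (-24 * Q.energyPerParticle lennardJones) * ∑ i, siteEnergy (fun r => (r⁻¹) ^ 12) x i) := by
  constructor
  · intro h
    refine ⟨stubPeriodicMinimiser_of_groundStateVarianceCertificate h, ?_⟩
    obtain ⟨P, C, _, heP, hcert⟩ := h
    intro N x _ hx _
    refine ⟨P, (hcert N x hx).trans ?_⟩
    exact mul_le_mul_of_nonneg_right (by linarith) (sum_siteEnergy_inv_pow_twelve_nonneg x)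
  · rintro ⟨hatt, hcore⟩
    exact groundStateVarianceCertificate_iff_attained_and_dominated.2
      ⟨hatt, periodicDomination_of_core hcore⟩

/-- **The core from the all-configuration certificate** (`VarianceCertificate`, item
stmt-AtomisticToContinuum-11861: the same inequality for every injective configuration, with a
periodic `P`, `e(P) ≤ -C/24`): take `Q := P` and use `C ≤ -24 e(P)`. [folklore] -/
theorem core_of_varianceCertificate
    (h : _root_.Summit.AtomisticToContinuum.Crystallization.Theses.PRVarianceCertificate.VarianceCertificate) :
    ∀ (N : ℕ) (x : Fin N → EuclideanSpace ℝ (Fin 3)), 5 ≤ N → IsGroundState lennardJones x →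
      ∑ i, siteEnergy (fun r => (r⁻¹) ^ 12) x i = ∑ i, siteEnergy (fun r => (r⁻¹) ^ 6) x i →
      ∃ Q : PeriodicConfiguration 3,
        ∑ i, (siteEnergy (fun r => (r⁻¹) ^ 6) x i) ^ 2 ≤
          (-24 * Q.energyPerParticle lennardJones) * ∑ i, siteEnergy (fun r => (r⁻¹) ^ 12) x i := by
  obtain ⟨P, C, _, heP, hcert⟩ := h
  intro N x _ hx _
  refine ⟨P, (hcert N x hx.1).trans ?_⟩
  exact mul_le_mul_of_nonneg_right (by linarith) (sum_siteEnergy_inv_pow_twelve_nonneg x)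

/-- **The core from the coercive certificate** (`CoerciveVarianceCertificate`, item
stmt-AtomisticToContinuum-11860): at `R = ε = 1` the counting term `c · #{bad sites}` is `≥ 0`, so the
deficit `C Σt - Σs²` is `≥ 0` for every ground state of `N ≥ 2` particles; again `Q := P`. [folklore] -/
theorem core_of_coerciveVarianceCertificate
    (h : _root_.Summit.AtomisticToContinuum.Crystallization.Theses.PRVarianceCertificate.CoerciveVarianceCertificate) :
    ∀ (N : ℕ) (x : Fin N → EuclideanSpace ℝ (Fin 3)), 5 ≤ N → IsGroundState lennardJones x →
      ∑ i, siteEnergy (fun r => (r⁻¹) ^ 12) x i = ∑ i, siteEnergy (fun r => (r⁻¹) ^ 6) x i →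
      ∃ Q : PeriodicConfiguration 3,
        ∑ i, (siteEnergy (fun r => (r⁻¹) ^ 6) x i) ^ 2 ≤
          (-24 * Q.energyPerParticle lennardJones) * ∑ i, siteEnergy (fun r => (r⁻¹) ^ 12) x i := by
  obtain ⟨P, C, _, heP, hco⟩ := h
  obtain ⟨c, hc, hcount⟩ := hco 1 1 one_pos one_pos
  intro N x hN hx _
  have hk := hcount N x hx (by omega)
  have h0 : 0 ≤ C * ∑ i, siteEnergy (fun r => (r⁻¹) ^ 12) x i -
      ∑ i, (siteEnergy (fun r => (r⁻¹) ^ 6) x i) ^ 2 :=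
    le_trans (mul_nonneg hc.le (Nat.cast_nonneg _)) hk
  refine ⟨P, ?_⟩
  have ht := sum_siteEnergy_inv_pow_twelve_nonneg x
  have hCP : C * ∑ i, siteEnergy (fun r => (r⁻¹) ^ 12) x i ≤
      (-24 * P.energyPerParticle lennardJones) * ∑ i, siteEnergy (fun r => (r⁻¹) ^ 12) x i :=
    mul_le_mul_of_nonneg_right (by linarith) ht
  linarith

end Summit.AtomisticToContinuum.Crystallization.Theorems.GroundStateVarianceCertificateLine

end
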